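import Summits.Schanuel.Schanuel.Theorems.ZilberEacParamFibreCurveZerosLim
import Summits.Schanuel.Schanuel.Theorems.ZilberEacParamFibreCurveGrowthFlat
import Summits.Schanuel.Schanuel.Theorems.ZilberEacParamFibreCurveTilt
import HarnessLib

/-!
# Polynomially parametrised base curves, L: the HORIZONTAL top row — fibre curves over
# polynomial curves are dense OFF THE EQUIMODULAR CIRCLE (all regimes)

HONEST FRAMING.  Cell `pub-schanuel` (Zilber's Exponential-Algebraic Closedness, case ladder;
host summit Schanuel), seat 2, gen 21.  After files XL (gap) and XLIII (tilted edge) the undecided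
fibre curves `Q ∈ ℂ[t, y₀]` over `(g₀, g₁)` with `2 ≤ d < n` have `d ∣ n`, vanishing phase, no gap,
and a top `t`-row spanning both extreme `y₀`-columns.  Along the zeros attached to the top row
(`μ = 0`: `e^{g₀(t_k)} → θ`, a nonzero root of the top-row polynomial `Q₀(y₀) = Σ_{m₀ = N₀} c_m y₀^{m₁}`;
engine of file XLVIII) the escape of `x₁ = g₁(t)` is decided at the order `‖t‖^{n-d}` by the
EQUIMODULAR FUNCTIONAL `Λ(θ) = e Re(c i^{e-1}) log ‖θ‖ + Re(D_{n-d} i^{e-1} / lc(g₀)^{e-1})`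
(`g₁ = c g₀^e + D`; growth lemma of file XLIX): **`unprojectedDense_paramSurface₃_of_y0_topRow`** —
`2 ≤ d < n`, `Q` irreducible with two top-row monomials of different `y₀`-degree, `θ ≠ 0` a root of
`Q₀` with `Λ(θ) ≠ 0` (canonical `c`, `D`) ⟹ `S(g; Q)` has Zariski-dense exponential points, in all
regimes.  Since `Re(c i^{e-1}) = ±‖c‖ ≠ 0`, `Λ(θ) = 0` is a single circle `‖θ‖ = ρ*`: the residual
class over polynomial curves is the EQUIMODULAR class (every nonzero top-row root on that circle),
exactly as over graph bases (gen 18); OPEN.  Mantova–Masser's question is OPEN in general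
(PLMS 2024 §1 p. 5); NOT Schanuel's conjecture (neither used nor implied; EAC ⇏ SC).
-/

noncomputable section

open Filter Topology Metric Set Complex MvPolynomial
open Literature.NumberTheory.Transcendental Literature.ModelTheory.Zilber
open Literature.ModelTheory.ExponentialFields

set_option linter.dupNamespace false

namespace Summit.Schanuel.Schanuel.Theorems

/-! ## Part A. Escaping exponential points along the top row -/

/-- **Zeros attached to the top row, with escape of `g₁ = c g₀^e + D` off the equimodular circle.**
`deg g₀ = d ≥ 2`, `Q ∈ ℂ[t, y₀]`, every monomial of `t`-degree `≤ N₀`, `θ ≠ 0` a root of the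
top-row polynomial `Q₀ ≠ 0`, `e ≥ 2`, `Re(c i^e) = 0`, `deg D ≤ d(e-1)`,
`Λ(θ) = e Re(c i^{e-1}) log ‖θ‖ + Re(D_{d(e-1)} i^{e-1}/lc(g₀)^{e-1}) ≠ 0`.  Then there are zeros `t_k`
of `Q(t, e^{g₀(t)})` with `|Re g₁(t_k)|/log(2 + ‖g₁(t_k)‖) → ∞`. (new) -/
theorem exists_paramSurface_expPoints_of_y0_flat (g₀ g₁ : Polynomial ℂ)
    (hd : 2 ≤ g₀.natDegree) (Q : MvPolynomial (Fin 3) ℂ)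
    (hQ2 : ∀ m ∈ Q.support, m 2 = 0) (N₀ : ℕ) (hN₀ : ∀ m ∈ Q.support, m 0 ≤ N₀)
    {θ : ℂ} (hθ0 : θ ≠ 0)
    (hθ : (∑ m ∈ Q.support.filter (fun m : Fin 3 →₀ ℕ => m 0 = N₀),
      Polynomial.C (Q.coeff m) * Polynomial.X ^ (m 1)).eval θ = 0)
    (hQ₀ : (∑ m ∈ Q.support.filter (fun m : Fin 3 →₀ ℕ => m 0 = N₀),
      Polynomial.C (Q.coeff m) * Polynomial.X ^ (m 1)) ≠ 0)
    {c : ℂ} {e : ℕ} (he : 2 ≤ e) {D : Polynomial ℂ}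
    (hD : g₁ = Polynomial.C c * g₀ ^ e + D) (hph : (c * I ^ e).re = 0)
    (hDdeg : D.natDegree ≤ g₀.natDegree * (e - 1))
    (hΛ : (e : ℝ) * (c * I ^ (e - 1)).re * Real.log ‖θ‖ +
      (D.coeff (g₀.natDegree * (e - 1)) * I ^ (e - 1) / g₀.leadingCoeff ^ (e - 1)).re ≠ 0)
    {ω : ℂ} {σ : ℤ} (hσ : σ = 1 ∨ σ = -1)
    (hω : g₀.leadingCoeff * ω ^ g₀.natDegree = 2 * Real.pi * I * σ) :
    ∃ t : ℕ → ℂ, (∀ k, MvPolynomial.eval ![t k, exp (g₀.eval (t k)), exp (g₁.eval (t k))] Q = 0) ∧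
      Tendsto (fun k => |(g₁.eval (t k)).re| / Real.log (2 + ‖g₁.eval (t k)‖)) atTop atTop := by
  classical
  set q : (Fin 3 →₀ ℕ) → Polynomial ℂ := fun m =>
    Polynomial.C (Q.coeff m) * Polynomial.X ^ (m 0) with hq_def
  set ex : (Fin 3 →₀ ℕ) → ℕ := fun m => m 1 with hex_def
  have hq_deg : ∀ m ∈ Q.support, (q m).natDegree = m 0 := fun m hm =>
    Polynomial.natDegree_C_mul_X_pow _ _ (MvPolynomial.mem_support_iff.1 hm)
  have hq_lc : ∀ m, (q m).leadingCoeff = Q.coeff m := fun m =>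
    Polynomial.leadingCoeff_C_mul_X_pow _ _
  -- the horizontal edge `μ = 0`, `κ = N₀`
  have hκ' : ∀ m ∈ Q.support, ((q m).natDegree : ℝ) + (0 : ℝ) * ex m ≤ (N₀ : ℝ) := fun m hm => by
    rw [hq_deg m hm, zero_mul, add_zero]; exact_mod_cast hN₀ m hm
  -- the engine's top polynomial is `Q₀`
  have hfilter : Q.support.filter (fun m => ((q m).natDegree : ℝ) + (0 : ℝ) * ex m = (N₀ : ℝ)) =
      Q.support.filter (fun m : Fin 3 →₀ ℕ => m 0 = N₀) := by
    refine Finset.filter_congr fun m hm => ?_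
    rw [hq_deg m hm, zero_mul, add_zero]
    exact_mod_cast Iff.rfl
  have hQμ : (∑ m ∈ Q.support.filter (fun m => ((q m).natDegree : ℝ) + (0 : ℝ) * ex m = (N₀ : ℝ)),
      Polynomial.C (q m).leadingCoeff * Polynomial.X ^ (ex m)) =
      ∑ m ∈ Q.support.filter (fun m : Fin 3 →₀ ℕ => m 0 = N₀),
        Polynomial.C (Q.coeff m) * Polynomial.X ^ (m 1) := by
    rw [hfilter]
    exact Finset.sum_congr rfl fun m _ => by rw [hq_lc]
  -- located zeros with the limit of the value
  obtain ⟨t, hnorm, ht, hlim⟩ := exists_zeros_log_dir_lim g₀ hd Q.support q ex 0 (N₀ : ℝ) hκ'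
    hθ0 (by rw [hQμ]; exact hθ) (by rw [hQμ]; exact hQ₀) ω σ hσ hω
  refine ⟨t, fun k => ?_, ?_⟩
  · rw [eval₃_eq_sum_coeffPoly_of_y0 Q hQ2]
    have h := ht k
    simpa only [hq_def, hex_def, ← Complex.exp_nat_mul, Polynomial.eval_mul, Polynomial.eval_C,
      Polynomial.eval_pow, Polynomial.eval_X] using h
  · have hlim' : Tendsto (fun k => (g₀.eval (t k)).re) atTop (𝓝 (Real.log ‖θ‖)) := by
      refine hlim.congr fun k => ?_
      rw [zero_mul, sub_zero]
    rw [hD]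
    exact tendsto_growth_eval_of_flat g₀ hd c e he hph D hDdeg hnorm hlim' hΛ

/-! ## Part B. The density theorems along the top row -/

section Main

variable (g₀ g₁ : Polynomial ℂ) {Q : MvPolynomial (Fin 3) ℂ}

/-- **Density along the top row, off the equimodular circle (any decomposition).**
[cite: MantovaMasser2023, §1 Further remarks, p. 5 (the question, open in general)] (new) -/
theorem unprojectedDense_paramSurface₃_of_y0_flat (hd : 2 ≤ g₀.natDegree)
    (hirr : Irreducible Q) (hQ2 : ∀ m ∈ Q.support, m 2 = 0) (N₀ : ℕ)
    (hN₀ : ∀ m ∈ Q.support, m 0 ≤ N₀) {θ : ℂ} (hθ0 : θ ≠ 0)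
    (hθ : (∑ m ∈ Q.support.filter (fun m : Fin 3 →₀ ℕ => m 0 = N₀),
      Polynomial.C (Q.coeff m) * Polynomial.X ^ (m 1)).eval θ = 0)
    (hQ₀ : (∑ m ∈ Q.support.filter (fun m : Fin 3 →₀ ℕ => m 0 = N₀),
      Polynomial.C (Q.coeff m) * Polynomial.X ^ (m 1)) ≠ 0)
    {c : ℂ} {e : ℕ} (he : 2 ≤ e) {D : Polynomial ℂ}
    (hD : g₁ = Polynomial.C c * g₀ ^ e + D) (hph : (c * I ^ e).re = 0)
    (hDdeg : D.natDegree ≤ g₀.natDegree * (e - 1))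
    (hΛ : (e : ℝ) * (c * I ^ (e - 1)).re * Real.log ‖θ‖ +
      (D.coeff (g₀.natDegree * (e - 1)) * I ^ (e - 1) / g₀.leadingCoeff ^ (e - 1)).re ≠ 0) :
    UnprojectedDense {w : Fin 2 ⊕ Fin 2 → ℂ | ∃ t : ℂ, w (Sum.inl 0) = g₀.eval t ∧
      w (Sum.inl 1) = g₁.eval t ∧
      MvPolynomial.eval (Fin.cases t (fun i => w (Sum.inr i)) : Fin 3 → ℂ) Q = 0} := by
  have hg₀ : 1 ≤ g₀.natDegree := by omega
  have hg0 : g₀ ≠ 0 := by rintro rfl; rw [Polynomial.natDegree_zero] at hd; omega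
  have ha0 : g₀.leadingCoeff ≠ 0 := Polynomial.leadingCoeff_ne_zero.2 hg0
  obtain ⟨ω, σ, hσ, hω, -⟩ := exists_rootDirection g₀.leadingCoeff ha0 g₀.natDegree hd
  obtain ⟨t, ht, hgr⟩ := exists_paramSurface_expPoints_of_y0_flat g₀ g₁ hd Q hQ2 N₀ hN₀ hθ0 hθ hQ₀
    he hD hph hDdeg hΛ hσ hω
  exact unprojectedDense_paramSurface₃_of_expPoints₁ g₀ g₁ Q ht hgr
    (isIrreducibleClosed_paramSurface₃ g₀ g₁ hg₀ hirr)
    (by rw [zariskiDim_paramSurface₃ g₀ g₁ hg₀ hirr])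

/-- **FIBRE CURVES ARE DENSE OFF THE EQUIMODULAR CIRCLE, ALL REGIMES.**  `2 ≤ d = deg g₀ < n = deg g₁`;
`Q ∈ ℂ[t, y₀]` irreducible with two `y₀`-degrees and a top-row monomial `ma` (`t`-degree `N₀`
maximal); `θ ≠ 0` a root of the top-row polynomial `Q₀` with `Λ(θ) ≠ 0` for the CANONICAL
decomposition (`e = n/d`, `c = lc(g₁)/lc(g₀)^e`, `D = lc(g₀)^{-e}(lc(g₀)^e g₁ - lc(g₁) g₀^e)`) ⟹ the
exponential points of `S(g; Q)` are Zariski dense (`d ∤ n` or phase ≠ 0: file XXI; gap: file XL;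
otherwise the top row).  [cite: MantovaMasser2023, §1 Further remarks, p. 5 (the question, open in
general)] (new) -/
theorem unprojectedDense_paramSurface₃_of_y0_topRow (hd : 2 ≤ g₀.natDegree)
    (hlt : g₀.natDegree < g₁.natDegree) (hirr : Irreducible Q) (hQ2 : ∀ m ∈ Q.support, m 2 = 0)
    (N₀ : ℕ) (hN₀ : ∀ m ∈ Q.support, m 0 ≤ N₀)
    {ma : Fin 3 →₀ ℕ} (hma : ma ∈ Q.support) (hma0 : ma 0 = N₀)
    (h1 : ∃ m ∈ Q.support, ∃ m' ∈ Q.support, m 1 ≠ m' 1) {θ : ℂ} (hθ0 : θ ≠ 0)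
    (hθ : (∑ m ∈ Q.support.filter (fun m : Fin 3 →₀ ℕ => m 0 = N₀),
      Polynomial.C (Q.coeff m) * Polynomial.X ^ (m 1)).eval θ = 0)
    (hΛ : ((g₁.natDegree / g₀.natDegree : ℕ) : ℝ) *
        (g₁.leadingCoeff / g₀.leadingCoeff ^ (g₁.natDegree / g₀.natDegree) *
          I ^ (g₁.natDegree / g₀.natDegree - 1)).re * Real.log ‖θ‖ +
      ((Polynomial.C ((g₀.leadingCoeff ^ (g₁.natDegree / g₀.natDegree))⁻¹) *
          (Polynomial.C (g₀.leadingCoeff ^ (g₁.natDegree / g₀.natDegree)) * g₁ -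
            Polynomial.C g₁.leadingCoeff * g₀ ^ (g₁.natDegree / g₀.natDegree))).coeff
          (g₀.natDegree * (g₁.natDegree / g₀.natDegree - 1)) *
        I ^ (g₁.natDegree / g₀.natDegree - 1) /
        g₀.leadingCoeff ^ (g₁.natDegree / g₀.natDegree - 1)).re ≠ 0) :
    UnprojectedDense {w : Fin 2 ⊕ Fin 2 → ℂ | ∃ t : ℂ, w (Sum.inl 0) = g₀.eval t ∧
      w (Sum.inl 1) = g₁.eval t ∧
      MvPolynomial.eval (Fin.cases t (fun i => w (Sum.inr i)) : Fin 3 → ℂ) Q = 0} := by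
  classical
  have hn : 1 ≤ g₁.natDegree := by omega
  by_cases hph : ¬ g₀.natDegree ∣ g₁.natDegree ∨
      (g₁.leadingCoeff * (I / g₀.leadingCoeff) ^ (g₁.natDegree / g₀.natDegree)).re ≠ 0
  · exact unprojectedDense_paramSurface₃_of_y0 g₀ g₁ hd hn hph hirr hQ2 h1
  push Not at hph
  obtain ⟨hdvd, hph0⟩ := hph
  by_cases hgap : g₁.natDegree <
      (Polynomial.C (g₀.leadingCoeff ^ (g₁.natDegree / g₀.natDegree)) * g₁ -
        Polynomial.C g₁.leadingCoeff * g₀ ^ (g₁.natDegree / g₀.natDegree)).natDegree + g₀.natDegree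
  · exact unprojectedDense_paramSurface₃_of_y0_gap_canonical g₀ g₁ hd hn hdvd hph0 hgap hirr hQ2 h1
  push Not at hgap
  have hg0 : g₀ ≠ 0 := by rintro rfl; rw [Polynomial.natDegree_zero] at hd; omega
  have hg1 : g₁ ≠ 0 := by rintro rfl; rw [Polynomial.natDegree_zero] at hn; omega
  have ha0 : g₀.leadingCoeff ≠ 0 := Polynomial.leadingCoeff_ne_zero.2 hg0
  set e := g₁.natDegree / g₀.natDegree with he_def
  set a := g₀.leadingCoeff with ha
  have hae : a ^ e ≠ 0 := pow_ne_zero _ ha0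
  have hne' : g₀.natDegree * e = g₁.natDegree := Nat.mul_div_cancel' hdvd
  have he2 : 2 ≤ e := by
    by_contra hlt2
    have : e ≤ 1 := by omega
    have := Nat.mul_le_mul_left g₀.natDegree this
    rw [hne', mul_one] at this
    omega
  set c : ℂ := g₁.leadingCoeff / a ^ e with hc_def
  set P := Polynomial.C (a ^ e) * g₁ - Polynomial.C g₁.leadingCoeff * g₀ ^ e with hP
  set D := Polynomial.C ((a ^ e)⁻¹) * P with hDdef
  have hD : g₁ = Polynomial.C c * g₀ ^ e + D := by
    rw [hDdef, hP, hc_def, div_eq_mul_inv, mul_sub, ← mul_assoc, ← mul_assoc, ← Polynomial.C_mul,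
      ← Polynomial.C_mul, inv_mul_cancel₀ hae, Polynomial.C_1, one_mul, mul_comm _⁻¹]
    ring
  have hDdeg : D.natDegree ≤ g₀.natDegree * (e - 1) := by
    rw [hDdef, Polynomial.natDegree_C_mul (inv_ne_zero hae)]
    have hmul : g₀.natDegree * (e - 1) + g₀.natDegree = g₀.natDegree * e := by
      rw [Nat.mul_sub_one, Nat.sub_add_cancel]
      exact Nat.le_mul_of_pos_right _ (by omega)
    have hgapP : P.natDegree + g₀.natDegree ≤ g₁.natDegree := hgap
    omega
  have hph' : (c * I ^ e).re = 0 := by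
    rw [hc_def, show g₁.leadingCoeff / a ^ e * I ^ e = g₁.leadingCoeff * (I / a) ^ e by
      rw [div_pow]; ring]
    exact hph0
  -- `Q₀ ≠ 0`: its coefficient at `ma 1` is `Q.coeff ma ≠ 0`
  have hQ₀ : (∑ m ∈ Q.support.filter (fun m : Fin 3 →₀ ℕ => m 0 = N₀),
      Polynomial.C (Q.coeff m) * Polynomial.X ^ (m 1)) ≠ 0 := by
    intro h0
    have hcoeff := congrArg (fun p : Polynomial ℂ => p.coeff (ma 1)) h0
    simp only [Polynomial.finsetSum_coeff, Polynomial.coeff_C_mul, Polynomial.coeff_X_pow,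
      Polynomial.coeff_zero] at hcoeff
    rw [Finset.sum_eq_single ma] at hcoeff
    · rw [if_pos rfl, mul_one] at hcoeff
      exact (MvPolynomial.mem_support_iff.1 hma) hcoeff
    · intro m hm hmne
      rw [if_neg, mul_zero]
      intro h11
      apply hmne
      obtain ⟨hmQ, hm0⟩ := Finset.mem_filter.1 hm
      ext i
      fin_cases i
      · exact hm0.trans hma0.symm
      · exact h11.symm
      · show m 2 = ma 2
        rw [hQ2 m hmQ, hQ2 ma hma]
    · intro h; exact (h (Finset.mem_filter.2 ⟨hma, hma0⟩)).elim
  have hΛ' : (e : ℝ) * (c * I ^ (e - 1)).re * Real.log ‖θ‖ +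
      (D.coeff (g₀.natDegree * (e - 1)) * I ^ (e - 1) / a ^ (e - 1)).re ≠ 0 := hΛ
  exact unprojectedDense_paramSurface₃_of_y0_flat g₀ g₁ hd hirr hQ2 N₀ hN₀ hθ0 hθ hQ₀ he2 hD hph'
    hDdeg hΛ'

end Main

end Summit.Schanuel.Schanuel.Theorems
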